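import Mathlib
import HarnessLib
import Summits.HubbardSuperconductivity.HubbardSuperconductivity.Theorems.WeakCouplingBCSWcbcsKohnLuttingerB1gKlCertForm
import Summits.HubbardSuperconductivity.HubbardSuperconductivity.Theorems.WeakCouplingBCSDefsKlCertB1gRecord
import Summits.HubbardSuperconductivity.HubbardSuperconductivity.Theorems.WeakCouplingBCSDefsKlThirdOrder

/-!
# Route `WeakCouplingBCS` — channel-margin lane of `WcbcsKohnLuttingerB1g` (stmt-HubbardSuperconductivity-0158):
# third-order `B1g` selection from a second-order record, a `U₀` row and the row's NAMED third-order enclosures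

The explicit-`U₀` rows (`KLU0Row`, `Theorems/WeakCouplingBCSDefsKlU0Record.lean`) conclude `lamB U < lamX U` on `0 < U ≤ U0` for ARBITRARY
functions obeying their expansion bounds (`klU0Row_sound`).  This file proves the rows' intended reading for the objects of
`Theorems/WeakCouplingBCSDefsKlThirdOrder.lean`: the truncated vertex form `Q_U(ψ) = thirdOrderForm ε₀ μ U ψ = (∫ψ dσ_μ)²/U + ⟨ψ, χ₀(k+k') ψ⟩
+ U ⟨ψ, K₃ ψ⟩` (the pp-irreducible Cooper vertex through THIRD order, divided by `U²`; `K₃ = χ₀(k-k')² + χ₀(k+k')² + T_V + T_P`).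
* `klto_b1g_ritz_state`: the normalised `B1g` Ritz trial of a record block with enclosures E1–E2 is a mean-zero channel state with
  `⟨ψ_B, χ₀ ψ_B⟩ ≤ rhohi` (the construction inside `klb1g_ritz_upper`); `klto_competitor_lower`: every normalised state of a competitor
  block with a certified lower bound has `(∫φ)² + ⟨φ, χ₀ φ⟩ ≥ lower` (`stub_klBlockBounds`, `stub_klFrameHS`); `klto_row_third_order`: a
  row through third order, `rhohi + U(c3B+tB) < low - U(s3+t)` on `(0, U0]` (`klU0Row_sound`; `c4B, s4, C4` enter only through their signs).
* **`klThirdOrder_bounds` / `klThirdOrder_selection_of_lower` / `klThirdOrder_selection`**: for a box passing `basicOKB1g` with its enclosures at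
  `μ` (item 0158's hypothesis `EnclosuresB1g`, read at `μ`), a row with `r.ok` and `r.dominates bx tab`, and the NAMED hypotheses
  `r.ThirdOrderEnclosures μ Φ_B`: for every `0 < U ≤ r.U0` the `B1g` state `ψ_B` lies STRICTLY below every normalised `A1g/A2g/B2g/E` state
  (`Q_U(ψ_B) ≤ rhohi + U(c3B+tB) < low - U(s3+t) ≤ Q_U(φ)`, using `1/U ≥ 1` for `U ≤ U1 ≤ 1`), hence below `channelInf3 ε₀ μ U χ`.
* `klThirdOrder_selection_d010_certfloor`: the instance at the level of `klCertB1gD010` (`μ₀ = -0.17983`, `δ ≈ 0.10`) with the CERTIFIED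
  floor row `klU0_d010_certfloor_nc16384_2loop_C4_0` (`U0 = 1215/2²⁰`); `…_t0float`: the same with the `T = 0` FLOAT row (`U0 = 1091/4096`),
  labelled as such.
Honest framing: conditional on the two named numerical hypotheses (certified by the cell's interval arithmetic in two implementations, not
in-kernel; FLOAT for the `t0float` instance); orders `≥ 4` are not addressed; nothing here asserts a pairing instability.  Cell file
`run/shared/lean/pub/gate-hubbard-kl/U0-TABLE.md` (v3.1 block).  References: S. Raghu, S. A. Kivelson, D. J. Scalapino, Phys. Rev. B 81 (2010)
224505, §V (25), App. A; M. Reed, B. Simon, *Methods of Modern Mathematical Physics IV*, §XIII.1.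
-/

noncomputable section

-- the tree's namespace `Summit.<Summit>.<Problem>.Theorems` repeats the summit name by design (D-0017)
set_option linter.dupNamespace false

namespace Summit.HubbardSuperconductivity.HubbardSuperconductivity.Theorems

open MeasureTheory Literature.MathematicalPhysics.QuantumLattice CwKLChiralWindow KlThirdOrder

/-! ### The `B1g` Ritz state of a record block -/

/-- **The normalised `B1g` Ritz trial.** If the `B1g` block `b` has usable Ritz data (`ritzOK`) and its Ritz enclosures E1–E2 hold
at `μ ∈ (-4,0)`, then with `Φ = b.trialFun tab`, `N = ∫Φ² dσ_μ > 0` and `c = 1/√N`: `ψ_B = c Φ` is a normalised `B1g` channel state,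
`∫ψ_B dσ_μ = 0`, and `⟨ψ_B, χ₀(k+k') ψ_B⟩ ≤ rhohi = max (Qhi/Nlo) (Qhi/Nhi)`. [folklore] -/
theorem klto_b1g_ritz_state {μ : ℝ} (hμ : μ ∈ Set.Ioo (-4 : ℝ) 0) (b : KLBlock) (tab : List KLTrig)
    (hR : b.ritzOK tab D4Irrep.B1g = true) (hE : b.RitzEnclosure tab μ) :
    ∃ c : ℝ, 0 < c ^ 2 ∧
      c ^ 2 * ∫ k, b.trialFun tab k ^ 2 ∂fermiCurveMeasure (squareDispersion 1 0) μ = 1 ∧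
      IsChannelState (squareDispersion 1 0) μ D4Irrep.B1g (fun k => c * b.trialFun tab k) ∧
      ∫ k, c * b.trialFun tab k ∂fermiCurveMeasure (squareDispersion 1 0) μ = 0 ∧
      kform (fermiCurveMeasure (squareDispersion 1 0) μ) (lindhardKernel (squareDispersion 1 0) μ)
          (fun k => c * b.trialFun tab k) ≤ ((b.rhohi : ℚ) : ℝ) := by
  have hR' := hR
  simp only [KLBlock.ritzOK, Bool.and_eq_true, decide_eq_true_eq] at hR'
  obtain ⟨⟨⟨⟨⟨⟨⟨-, -⟩, hfits⟩, hNlo⟩, -⟩, -⟩, hQhi⟩, hwu⟩ := hR'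
  have hw : b.withU = false := by
    cases h : b.withU with
    | false => rfl
    | true => rw [h] at hwu; simp at hwu
  obtain ⟨h1, h2, h3, h4⟩ := hE
  obtain ⟨hN, -, hρhi, -, -⟩ := kl_bkb_arith (Thi := 0) (T := 0) (by exact_mod_cast hNlo) (by exact_mod_cast hQhi)
    le_rfl h1 h2 h3 h4 le_rfl
  have hrhohi : ((b.rhohi : ℚ) : ℝ) = max ((b.Qhi : ℝ) / (b.Nlo : ℝ)) ((b.Qhi : ℝ) / (b.Nhi : ℝ)) := by
    push_cast [KLBlock.rhohi]; rfl
  rw [← hrhohi] at hρhi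
  set σ := fermiCurveMeasure (squareDispersion 1 0) μ with hσ
  set Φ : Momentum → ℝ := b.trialFun tab with hΦ
  set N : ℝ := ∫ k, Φ k ^ 2 ∂σ with hNdef
  haveI hfin : IsFiniteMeasure σ := stub_klFiniteMeasure stub_klGradient stub_klHausdorffFinite μ hμ
  have hinv := stub_klD4Invariant stub_klGradient μ hμ
  have hΦmem : MemLp Φ 2 σ := kl_tr_toFun_memLp (klTab tab b.trial) hμ
  have hΦch : InChannel D4Irrep.B1g Φ := stub_klTrigChannel (klTab tab b.trial) D4Irrep.B1g hfits
  set c : ℝ := (Real.sqrt N)⁻¹ with hc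
  have hsqrt : 0 < Real.sqrt N := Real.sqrt_pos.2 hN
  have hc2N : c ^ 2 * N = 1 := by
    rw [hc, inv_pow, Real.sq_sqrt hN.le, inv_mul_cancel₀ hN.ne']
  have hc2 : 0 < c ^ 2 := by positivity
  have hψmem : MemLp (fun k => c * Φ k) 2 σ := hΦmem.const_mul c
  have hψch : InChannel D4Irrep.B1g (fun k => c * Φ k) := by
    have h := kl_hc_inChannel_linear D4Irrep.B1g Φ Φ c 0 hΦch hΦch
    simpa using h
  have hψnorm : ∫ k, (c * Φ k) ^ 2 ∂σ = 1 := by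
    simp only [mul_pow]
    rw [integral_const_mul]
    exact hc2N
  have hstate : IsChannelState (squareDispersion 1 0) μ D4Irrep.B1g (fun k => c * Φ k) := ⟨hψmem, hψnorm, hψch⟩
  have hmean : ∫ k, c * Φ k ∂σ = 0 :=
    (stub_klMeanZero _ _ hfin hinv D4Irrep.B1g (fun k => c * Φ k) (by decide) hstate).2
  refine ⟨c, hc2, hc2N, hstate, hmean, ?_⟩
  have hker : ∀ k k', b.baseKernel μ k k' = lindhardKernel (squareDispersion 1 0) μ k k' := by
    intro k k'
    rw [KLBlock.baseKernel, hw, lindhardKernel]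
    simp
  have hQ : kform σ (lindhardKernel (squareDispersion 1 0) μ) Φ ≤ ((b.rhohi : ℚ) : ℝ) * N := by
    have hrw : kform σ (lindhardKernel (squareDispersion 1 0) μ) Φ =
        ∫ k, Φ k * ∫ k', b.baseKernel μ k k' * Φ k' ∂σ ∂σ := by
      simp_rw [hker]; rfl
    rw [hrw]
    exact hρhi
  calc kform σ (lindhardKernel (squareDispersion 1 0) μ) (fun k => c * Φ k)
      = c ^ 2 * kform σ (lindhardKernel (squareDispersion 1 0) μ) Φ := kform_smul σ _ Φ c
    _ ≤ c ^ 2 * (((b.rhohi : ℚ) : ℝ) * N) := mul_le_mul_of_nonneg_left hQ hc2.le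
    _ = ((b.rhohi : ℚ) : ℝ) * (c ^ 2 * N) := by ring
    _ = ((b.rhohi : ℚ) : ℝ) := by rw [hc2N, mul_one]

/-- **Competitor states.** If `L ≤ channelInf ε₀ μ 1 χ` (a certified lower bound of the `U = 1` channel bottom, e.g.
`stub_klBlockBounds` / `klb1gd_blockLower` of a record block) and `μ ∈ (-4,0)`, then every normalised channel state `φ` of `χ` satisfies
`L ≤ (∫φ dσ_μ)² + ⟨φ, χ₀(k+k') φ⟩` (its `U = 1` pairing form, split by the Hilbert–Schmidt frame `stub_klFrameHS`). [folklore] -/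
theorem klto_competitor_lower {μ L : ℝ} (hμ : μ ∈ Set.Ioo (-4 : ℝ) 0) (χ : D4Irrep)
    (hL : L ≤ channelInf (squareDispersion 1 0) μ 1 χ) (φ : Momentum → ℝ)
    (hφ : IsChannelState (squareDispersion 1 0) μ χ φ) :
    L ≤ (∫ k, φ k ∂fermiCurveMeasure (squareDispersion 1 0) μ) ^ 2 +
        kform (fermiCurveMeasure (squareDispersion 1 0) μ) (lindhardKernel (squareDispersion 1 0) μ) φ := by
  have hval : channelInf (squareDispersion 1 0) μ 1 χ ≤ pairingForm (squareDispersion 1 0) μ 1 φ :=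
    csInf_le (klb1g_bddBelow hμ χ) ⟨φ, hφ, rfl⟩
  obtain ⟨hsplit, -⟩ := stub_klFrameHS stub_klKernelHS μ hμ 1 φ hφ.1
  have heq : pairingForm (squareDispersion 1 0) μ 1 φ =
      (∫ k, φ k ∂fermiCurveMeasure (squareDispersion 1 0) μ) ^ 2 +
        kform (fermiCurveMeasure (squareDispersion 1 0) μ) (lindhardKernel (squareDispersion 1 0) μ) φ := by
    rw [hsplit, one_mul, one_pow, one_mul]
    rfl
  linarith

/-- **A row through third order.** If `r.ok` and `c` is one of the row's competitors, then for `0 < U ≤ U0`: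
`rhohi + U (c3B + tB) < low - U (s3 + t)` (`klU0Row_sound` with `lamB U := rhohi + U(c3B+tB)`, `lamX U := low - U(s3+t)`; the
`U²` terms only enter through `c4B, s4, C4 ≥ 0`). [folklore] -/
theorem klto_row_third_order (r : KLU0Row) (hr : r.ok = true) (c : KLU0Chan) (hc : c ∈ r.chans) :
    ∀ U : ℝ, 0 < U → U ≤ r.U0 →
      (r.rhohi : ℝ) + U * ((r.c3B : ℝ) + r.tB) < (c.low : ℝ) - U * ((c.s3 : ℝ) + c.t) := by
  have hr' := hr
  simp only [KLU0Row.ok, KLU0Row.endpoint, Bool.and_eq_true, decide_eq_true_eq, List.all_eq_true] at hr'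
  obtain ⟨⟨⟨⟨-, -⟩, hc4⟩, hC4⟩, hall⟩ := hr'
  obtain ⟨⟨-, hs4⟩, -⟩ := hall c hc
  refine klU0Row_sound r hr c hc (fun U => (r.rhohi : ℝ) + U * ((r.c3B : ℝ) + r.tB))
    (fun U => (c.low : ℝ) - U * ((c.s3 : ℝ) + c.t)) (fun U hU _ => ?_) (fun U hU _ => ?_)
  · have h1 : (0 : ℝ) ≤ r.c4B := by exact_mod_cast hc4
    have h2 : (0 : ℝ) ≤ r.C4 := by exact_mod_cast hC4
    nlinarith [sq_nonneg U]
  · have h1 : (0 : ℝ) ≤ c.s4 := by exact_mod_cast hs4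
    have h2 : (0 : ℝ) ≤ r.C4 := by exact_mod_cast hC4
    nlinarith [sq_nonneg U]

/-- Reading `KLU0Row.dominates`. [folklore] -/
theorem klto_dominates_spec (r : KLU0Row) (bx : KLBox) (tab : List KLTrig) (h : r.dominates bx tab = true) :
    bx.bB1g.rhohi ≤ r.rhohi ∧ r.chans.length = 4 ∧ r.U1 ≤ 1 ∧
      ∀ χ : D4Irrep, χ ≠ D4Irrep.B1g → (r.chanOf χ).low ≤ (bx.blk χ).lower tab χ := by
  simp only [KLU0Row.dominates, Bool.and_eq_true, decide_eq_true_eq] at h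
  obtain ⟨⟨⟨⟨⟨⟨h1, h2⟩, h3⟩, hA1⟩, hA2⟩, hB2⟩, hE⟩ := h
  refine ⟨h1, h2, h3, fun χ hχ => ?_⟩
  cases χ with
  | A1g => exact hA1
  | A2g => exact hA2
  | B1g => exact absurd rfl hχ
  | B2g => exact hB2
  | E => exact hE

/-- The row's datum for a competitor channel is one of its `chans` (rows list exactly four). [folklore] -/
theorem klto_chanOf_mem (r : KLU0Row) (hlen : r.chans.length = 4) (χ : D4Irrep) (hχ : χ ≠ D4Irrep.B1g) :
    r.chanOf χ ∈ r.chans := by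
  have key : ∀ i : ℕ, i < 4 → r.chans.getD i ⟨"", 0, 0, 0, 0⟩ ∈ r.chans := by
    intro i hi
    rw [List.getD_eq_getElem _ _ (by omega)]
    exact List.getElem_mem _
  cases χ with
  | A1g => exact key 0 (by norm_num)
  | A2g => exact key 1 (by norm_num)
  | B1g => exact absurd rfl hχ
  | B2g => exact key 2 (by norm_num)
  | E => exact key 3 (by norm_num)

/-- **The two-sided bounds behind third-order selection.**  Let `bx` be a box of a second-order record whose `B1g` block has usable
Ritz data with enclosures E1–E2 at `μ ∈ (-4,0)`, and whose four competitor blocks' bounds `lower` are certified lower bounds of the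
`U = 1` channel bottoms at `μ`; let `r` be a `U₀` row consistent with the box (`r.dominates bx tab`) whose named third-order hypotheses
`r.ThirdOrderEnclosures μ Φ_B` hold for the box's `B1g` trial `Φ_B`.  Then the normalised trial `ψ_B` is a `B1g` channel state with
`thirdOrderForm ε₀ μ U ψ_B ≤ rhohi + U (c3B + tB)` for every `U > 0`, and every normalised state `φ` of a competitor channel `χ` obeys
`low(χ) - U (s3(χ) + t(χ)) ≤ thirdOrderForm ε₀ μ U φ` for `0 < U ≤ 1` (row data `r.chanOf χ`). [folklore] -/
theorem klThirdOrder_bounds {μ : ℝ} (hμ : μ ∈ Set.Ioo (-4 : ℝ) 0) (bx : KLBox) (tab : List KLTrig)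
    (hritz : bx.bB1g.ritzOK tab D4Irrep.B1g = true) (hER : bx.bB1g.RitzEnclosure tab μ)
    (hlower : ∀ χ : D4Irrep, χ ≠ D4Irrep.B1g →
      (((bx.blk χ).lower tab χ : ℚ) : ℝ) ≤ channelInf (squareDispersion 1 0) μ 1 χ)
    (r : KLU0Row) (hdom : r.dominates bx tab = true)
    (h3 : r.ThirdOrderEnclosures μ (bx.bB1g.trialFun tab)) :
    ∃ ψ : Momentum → ℝ, IsChannelState (squareDispersion 1 0) μ D4Irrep.B1g ψ ∧
      (∀ U : ℝ, 0 < U →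
        thirdOrderForm (squareDispersion 1 0) μ U ψ ≤ (r.rhohi : ℝ) + U * ((r.c3B : ℝ) + r.tB)) ∧
      (∀ U : ℝ, 0 < U → U ≤ 1 → ∀ χ : D4Irrep, χ ≠ D4Irrep.B1g →
        ∀ φ : Momentum → ℝ, IsChannelState (squareDispersion 1 0) μ χ φ →
          ((r.chanOf χ).low : ℝ) - U * (((r.chanOf χ).s3 : ℝ) + (r.chanOf χ).t) ≤
            thirdOrderForm (squareDispersion 1 0) μ U φ) := by
  obtain ⟨hrho, -, -, hlow⟩ := klto_dominates_spec r bx tab hdom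
  obtain ⟨h3B, h3χ⟩ := h3
  set σ := fermiCurveMeasure (squareDispersion 1 0) μ with hσ
  set Φ : Momentum → ℝ := bx.bB1g.trialFun tab with hΦ
  obtain ⟨c, hc2, hc2N, hstate, hmean, hform2⟩ := klto_b1g_ritz_state hμ bx.bB1g tab hritz hER
  refine ⟨fun k => c * Φ k, hstate, fun U hU => ?_, fun U hU hU1 χ hχ φ hφ => ?_⟩
  · -- upper side: Q_U(ψ_B) ≤ rhohi + U (c3B + tB)
    have hform3 : kform σ (klThirdOrderKernel (squareDispersion 1 0) μ) (fun k => c * Φ k) ≤ ((r.c3B + r.tB : ℚ) : ℝ) := by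
      have h := h3B
      unfold KLU0Row.B1gThirdOrderBound at h
      calc kform σ (klThirdOrderKernel (squareDispersion 1 0) μ) (fun k => c * Φ k)
          = c ^ 2 * kform σ (klThirdOrderKernel (squareDispersion 1 0) μ) Φ := kform_smul σ _ Φ c
        _ ≤ c ^ 2 * ((((r.c3B + r.tB : ℚ) : ℝ)) * ∫ k, Φ k ^ 2 ∂σ) := mul_le_mul_of_nonneg_left h hc2.le
        _ = (((r.c3B + r.tB : ℚ) : ℝ)) * (c ^ 2 * ∫ k, Φ k ^ 2 ∂σ) := by ring
        _ = ((r.c3B + r.tB : ℚ) : ℝ) := by rw [hc2N, mul_one]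
    unfold thirdOrderForm
    rw [hmean]
    have h1 : ((bx.bB1g.rhohi : ℚ) : ℝ) ≤ r.rhohi := by exact_mod_cast hrho
    have h2 : U * kform σ (klThirdOrderKernel (squareDispersion 1 0) μ) (fun k => c * Φ k) ≤
        U * (((r.c3B + r.tB : ℚ) : ℝ)) := mul_le_mul_of_nonneg_left hform3 hU.le
    push_cast at h2
    have h0 : (0 : ℝ) ^ 2 / U = 0 := by simp
    linarith [hform2]
  · -- lower side: low - U (s3 + t) ≤ Q_U(φ)
    have hlo2 := klto_competitor_lower hμ χ (hlower χ hχ) φ hφ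
    have hlo3 : -(((r.chanOf χ).s3 + (r.chanOf χ).t : ℚ) : ℝ) ≤
        kform σ (klThirdOrderKernel (squareDispersion 1 0) μ) φ := h3χ χ hχ φ hφ
    have hlowq : (((r.chanOf χ).low : ℚ) : ℝ) ≤ ((bx.blk χ).lower tab χ : ℝ) := by exact_mod_cast hlow χ hχ
    unfold thirdOrderForm
    have hsq : (∫ k, φ k ∂σ) ^ 2 ≤ (∫ k, φ k ∂σ) ^ 2 / U := by
      rw [le_div_iff₀ hU]
      have := sq_nonneg (∫ k, φ k ∂σ)
      nlinarith
    have h2 : U * -(((r.chanOf χ).s3 + (r.chanOf χ).t : ℚ) : ℝ) ≤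
        U * kform σ (klThirdOrderKernel (squareDispersion 1 0) μ) φ := mul_le_mul_of_nonneg_left hlo3 hU.le
    push_cast at h2
    linarith

/-- **Third-order selection from the two-sided bounds and a row** (generic form): with the hypotheses of `klThirdOrder_bounds` and
`r.ok`, for every `0 < U ≤ r.U0` the `B1g` state lies strictly below every normalised competitor state, below `channelInf3 ε₀ μ U χ`
whenever the competitor channel has a state, and `channelInf3 … B1g < channelInf3 … χ` as soon as the form is bounded below on the
`B1g` states. [folklore] -/
theorem klThirdOrder_selection_of_lower {μ : ℝ} (hμ : μ ∈ Set.Ioo (-4 : ℝ) 0) (bx : KLBox) (tab : List KLTrig)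
    (hritz : bx.bB1g.ritzOK tab D4Irrep.B1g = true) (hER : bx.bB1g.RitzEnclosure tab μ)
    (hlower : ∀ χ : D4Irrep, χ ≠ D4Irrep.B1g →
      (((bx.blk χ).lower tab χ : ℚ) : ℝ) ≤ channelInf (squareDispersion 1 0) μ 1 χ)
    (r : KLU0Row) (hr : r.ok = true) (hdom : r.dominates bx tab = true)
    (h3 : r.ThirdOrderEnclosures μ (bx.bB1g.trialFun tab)) :
    ∃ ψ : Momentum → ℝ, IsChannelState (squareDispersion 1 0) μ D4Irrep.B1g ψ ∧
      ∀ U : ℝ, 0 < U → U ≤ r.U0 → ∀ χ : D4Irrep, χ ≠ D4Irrep.B1g →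
        (∀ φ : Momentum → ℝ, IsChannelState (squareDispersion 1 0) μ χ φ →
          thirdOrderForm (squareDispersion 1 0) μ U ψ < thirdOrderForm (squareDispersion 1 0) μ U φ) ∧
        ((∃ φ : Momentum → ℝ, IsChannelState (squareDispersion 1 0) μ χ φ) →
          thirdOrderForm (squareDispersion 1 0) μ U ψ < channelInf3 (squareDispersion 1 0) μ U χ ∧
          (BddBelow (thirdOrderForm (squareDispersion 1 0) μ U ''
              {ψ' | IsChannelState (squareDispersion 1 0) μ D4Irrep.B1g ψ'}) →
            channelInf3 (squareDispersion 1 0) μ U D4Irrep.B1g < channelInf3 (squareDispersion 1 0) μ U χ)) := by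
  obtain ⟨-, hlen, hU1, -⟩ := klto_dominates_spec r bx tab hdom
  have hr' := hr
  simp only [KLU0Row.ok, Bool.and_eq_true, decide_eq_true_eq] at hr'
  obtain ⟨⟨⟨⟨-, hU01⟩, -⟩, -⟩, -⟩ := hr'
  obtain ⟨ψ, hψ, hup, hdown⟩ := klThirdOrder_bounds hμ bx tab hritz hER hlower r hdom h3
  refine ⟨ψ, hψ, fun U hU hUU χ hχ => ?_⟩
  have hUle1 : U ≤ 1 := by
    have h1 : ((r.U0 : ℚ) : ℝ) ≤ r.U1 := by exact_mod_cast hU01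
    have h2 : ((r.U1 : ℚ) : ℝ) ≤ 1 := by exact_mod_cast hU1
    linarith
  have hrow := klto_row_third_order r hr (r.chanOf χ) (klto_chanOf_mem r hlen χ hχ) U hU hUU
  refine ⟨fun φ hφ => by linarith [hup U hU, hdown U hU hUle1 χ hχ φ hφ], fun hne => ?_⟩
  obtain ⟨φ₀, hφ₀⟩ := hne
  have hne' : (thirdOrderForm (squareDispersion 1 0) μ U ''
      {φ | IsChannelState (squareDispersion 1 0) μ χ φ}).Nonempty := ⟨_, ⟨φ₀, hφ₀, rfl⟩⟩
  have hinf : ((r.chanOf χ).low : ℝ) - U * (((r.chanOf χ).s3 : ℝ) + (r.chanOf χ).t) ≤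
      channelInf3 (squareDispersion 1 0) μ U χ := by
    unfold channelInf3
    refine le_csInf hne' ?_
    rintro x ⟨φ, hφ, rfl⟩
    exact hdown U hU hUle1 χ hχ φ hφ
  have hlt : thirdOrderForm (squareDispersion 1 0) μ U ψ < channelInf3 (squareDispersion 1 0) μ U χ := by
    linarith [hup U hU]
  refine ⟨hlt, fun hbdd => lt_of_le_of_lt ?_ hlt⟩
  unfold channelInf3
  exact csInf_le hbdd ⟨ψ, hψ, rfl⟩

/-- The certified lower bounds of a box passing `basicOKB1g` (Temple / far-channel data, `stub_klBlockBounds`), given the block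
enclosures at `μ`. [folklore] -/
theorem klto_lower_of_basicOKB1g {μ : ℝ} (hμ : μ ∈ Set.Ioo (-4 : ℝ) 0) (bx : KLBox) (tab : List KLTrig)
    (hB : bx.basicOKB1g tab = true) (hE : ∀ χ : D4Irrep, χ ≠ D4Irrep.B1g → (bx.blk χ).Enclosure tab μ χ) :
    bx.bB1g.ritzOK tab D4Irrep.B1g = true ∧ ∀ χ : D4Irrep, χ ≠ D4Irrep.B1g →
      (((bx.blk χ).lower tab χ : ℚ) : ℝ) ≤ channelInf (squareDispersion 1 0) μ 1 χ := by
  have hB' := hB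
  simp only [KLBox.basicOKB1g, Bool.and_eq_true, decide_eq_true_eq] at hB'
  obtain ⟨⟨⟨⟨⟨⟨⟨-, -⟩, -⟩, hritz⟩, hA1⟩, hA2⟩, hB2⟩, hEE⟩ := hB'
  refine ⟨hritz, fun χ hχ => (stub_klBlockBounds μ hμ (bx.blk χ) tab χ (hE χ hχ)).1 ?_⟩
  cases χ with
  | A1g => exact hA1
  | A2g => exact hA2
  | B1g => exact absurd rfl hχ
  | B2g => exact hB2
  | E => exact hEE

/-- **Third-order `B1g` selection** (pointwise form).  Let `bx` be a box of a second-order record passing `basicOKB1g`, `μ ∈ (-4,0)` a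
level at which the Ritz enclosures of its `B1g` block and the enclosures of its four competitor blocks hold (item 0158's `EnclosuresB1g`,
read at `μ`); let `r` be a `U₀` row with `r.ok`, consistent with the box (`r.dominates bx tab`), whose named third-order hypotheses
`r.ThirdOrderEnclosures μ Φ_B` hold.  Then the normalised `B1g` trial `ψ_B` is a channel state such that for every `0 < U ≤ r.U0`, every
competitor `χ ∈ {A1g, A2g, B2g, E}` and every normalised channel state `φ` of `χ`: `thirdOrderForm ε₀ μ U ψ_B < thirdOrderForm ε₀ μ U φ` —
in the particle–particle-irreducible Cooper vertex through third order the `B1g` channel lies strictly below every competitor.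
(Chain: `≤ rhohi + U(c3B+tB)` `<` [row] `low - U(s3+t) ≤`.) [cite: RaghuKivelsonScalapino2010, App. A] -/
theorem klThirdOrder_selection {μ : ℝ} (hμ : μ ∈ Set.Ioo (-4 : ℝ) 0) (bx : KLBox) (tab : List KLTrig)
    (hB : bx.basicOKB1g tab = true) (hER : bx.bB1g.RitzEnclosure tab μ)
    (hE : ∀ χ : D4Irrep, χ ≠ D4Irrep.B1g → (bx.blk χ).Enclosure tab μ χ)
    (r : KLU0Row) (hr : r.ok = true) (hdom : r.dominates bx tab = true)
    (h3 : r.ThirdOrderEnclosures μ (bx.bB1g.trialFun tab)) :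
    ∃ ψ : Momentum → ℝ, IsChannelState (squareDispersion 1 0) μ D4Irrep.B1g ψ ∧
      ∀ U : ℝ, 0 < U → U ≤ r.U0 → ∀ χ : D4Irrep, χ ≠ D4Irrep.B1g →
        ∀ φ : Momentum → ℝ, IsChannelState (squareDispersion 1 0) μ χ φ →
          thirdOrderForm (squareDispersion 1 0) μ U ψ < thirdOrderForm (squareDispersion 1 0) μ U φ := by
  obtain ⟨hritz, hlower⟩ := klto_lower_of_basicOKB1g hμ bx tab hB hE
  obtain ⟨ψ, hψ, h⟩ := klThirdOrder_selection_of_lower hμ bx tab hritz hER hlower r hr hdom h3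
  exact ⟨ψ, hψ, fun U hU hUU χ hχ => (h U hU hUU χ hχ).1⟩

/-! ### The instance at `δ ≈ 0.10`: record `klCertB1gD010`, certified floor row `klU0_d010_certfloor_nc16384_2loop_C4_0` -/

/-- Kernel decision: the certified-floor row `klU0_d010_certfloor_nc16384_2loop_C4_0` is consistent with (the box of) the record
`klCertB1gD010` — same `rhohi`, same four lower bounds, four competitors, `U1 = 3/10 ≤ 1`. [folklore] -/
theorem klto_d010_certfloor_dominates :
    (klCertB1gD010.boxes.all fun bx => klU0_d010_certfloor_nc16384_2loop_C4_0.dominates bx klCertB1gD010.trials) = true := by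
  decide +kernel

/-- Kernel decision: the `T = 0`-float row `klU0_d010_t0float_2loop_C4_0` is consistent with the record `klCertB1gD010`. [folklore] -/
theorem klto_d010_t0float_dominates :
    (klCertB1gD010.boxes.all fun bx => klU0_d010_t0float_2loop_C4_0.dominates bx klCertB1gD010.trials) = true := by
  decide +kernel

/-- **Third-order selection at the level of the `δ ≈ 0.10` record, for ANY consistent row** `r` (`r.ok`, `r.dominates` the box):
modulo `klCertB1gD010.EnclosuresB1g` (item 0158's own named hypothesis) and `r.ThirdOrderEnclosures μ₀ Φ_B`, some `B1g` state lies strictly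
below every normalised `A1g/A2g/B2g/E` state in `thirdOrderForm ε₀ μ₀ U` for all `0 < U ≤ r.U0` (`μ₀ = bx.mulo`, the record's one level
`-0.17983` in binary64). [cite: RaghuKivelsonScalapino2010, App. A] -/
theorem klThirdOrder_selection_d010_of_row (hE : klCertB1gD010.EnclosuresB1g) (r : KLU0Row) (hr : r.ok = true)
    (hdom : (klCertB1gD010.boxes.all fun bx => r.dominates bx klCertB1gD010.trials) = true) :
    ∀ bx ∈ klCertB1gD010.boxes,
      r.ThirdOrderEnclosures ((bx.mulo : ℚ) : ℝ) (bx.bB1g.trialFun klCertB1gD010.trials) →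
        ∃ ψ : Momentum → ℝ, IsChannelState (squareDispersion 1 0) ((bx.mulo : ℚ) : ℝ) D4Irrep.B1g ψ ∧
          ∀ U : ℝ, 0 < U → U ≤ r.U0 → ∀ χ : D4Irrep, χ ≠ D4Irrep.B1g →
            ∀ φ : Momentum → ℝ, IsChannelState (squareDispersion 1 0) ((bx.mulo : ℚ) : ℝ) χ φ →
              thirdOrderForm (squareDispersion 1 0) ((bx.mulo : ℚ) : ℝ) U ψ <
                thirdOrderForm (squareDispersion 1 0) ((bx.mulo : ℚ) : ℝ) U φ := by
  intro bx hbx h3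
  have hall := List.all_eq_true.1 klCertB1gD010_boxes_all bx hbx
  simp only [Bool.and_eq_true] at hall
  have hB := hall.1
  have hB' := hB
  simp only [KLBox.basicOKB1g, Bool.and_eq_true, decide_eq_true_eq] at hB'
  obtain ⟨⟨⟨⟨⟨⟨⟨h4, hle⟩, h0⟩, -⟩, -⟩, -⟩, -⟩, -⟩ := hB'
  have hμI : ((bx.mulo : ℚ) : ℝ) ∈ Set.Icc ((bx.mulo : ℚ) : ℝ) ((bx.muhi : ℚ) : ℝ) :=
    ⟨le_rfl, by exact_mod_cast hle⟩
  have hμ : ((bx.mulo : ℚ) : ℝ) ∈ Set.Ioo (-4 : ℝ) 0 :=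
    ⟨by exact_mod_cast h4, lt_of_le_of_lt (by exact_mod_cast hle : ((bx.mulo : ℚ) : ℝ) ≤ bx.muhi) (by exact_mod_cast h0)⟩
  obtain ⟨hER, hEχ⟩ := hE bx hbx _ hμI
  exact klThirdOrder_selection hμ bx klCertB1gD010.trials hB hER hEχ r hr (List.all_eq_true.1 hdom bx hbx) h3

/-- **`B1g` selection survives the complete third order of the pp-irreducible Cooper vertex at `δ ≈ 0.10` for `0 < U ≤ 1215/2²⁰`** —
modulo two NAMED numerical hypotheses: `klCertB1gD010.EnclosuresB1g` (item 0158's own; kit j240360/j242368) and the certified-floor row's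
`klU0_d010_certfloor_nc16384_2loop_C4_0.ThirdOrderEnclosures μ₀ Φ_B` (chains: kit j247393/j247690; two-loop `T = 0` floor `tB = 28.271`,
`t = 24.477/26.895`, U0-TABLE v2 §3b, numpy-outward AND Arb, assembly kit j268768).  Existence-grade threshold; nothing here asserts a
pairing instability. [cite: RaghuKivelsonScalapino2010, App. A] -/
theorem klThirdOrder_selection_d010_certfloor (hE : klCertB1gD010.EnclosuresB1g) :
    ∀ bx ∈ klCertB1gD010.boxes,
      klU0_d010_certfloor_nc16384_2loop_C4_0.ThirdOrderEnclosures ((bx.mulo : ℚ) : ℝ)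
          (bx.bB1g.trialFun klCertB1gD010.trials) →
        ∃ ψ : Momentum → ℝ, IsChannelState (squareDispersion 1 0) ((bx.mulo : ℚ) : ℝ) D4Irrep.B1g ψ ∧
          ∀ U : ℝ, 0 < U → U ≤ 1215 / 1048576 → ∀ χ : D4Irrep, χ ≠ D4Irrep.B1g →
            ∀ φ : Momentum → ℝ, IsChannelState (squareDispersion 1 0) ((bx.mulo : ℚ) : ℝ) χ φ →
              thirdOrderForm (squareDispersion 1 0) ((bx.mulo : ℚ) : ℝ) U ψ <
                thirdOrderForm (squareDispersion 1 0) ((bx.mulo : ℚ) : ℝ) U φ := by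
  intro bx hbx h3
  obtain ⟨ψ, hψ, h⟩ := klThirdOrder_selection_d010_of_row hE _ klU0_d010_certfloor_nc16384_2loop_C4_0_ok
    klto_d010_certfloor_dominates bx hbx h3
  refine ⟨ψ, hψ, fun U hU hUU => h U hU ?_⟩
  have hU0 : klU0_d010_certfloor_nc16384_2loop_C4_0.U0 = (1215 : ℚ) / 1048576 := rfl
  rw [hU0]
  push_cast
  exact hUU

/-- **The same reading with the `T = 0` FLOAT two-loop allowances** (row `klU0_d010_t0float_2loop_C4_0`, `U0 = 1091/4096 ≈ 0.266`): its
`ThirdOrderEnclosures` carry `tB = 0.370`, `t = 0.163/0.010/0.494/0.152`, FLOAT-evaluated, NOT certified (U0-TABLE v1 §0) — the third-order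
threshold once the two-loop allowances are certified near their float values. [cite: RaghuKivelsonScalapino2010, App. A] -/
theorem klThirdOrder_selection_d010_t0float (hE : klCertB1gD010.EnclosuresB1g) :
    ∀ bx ∈ klCertB1gD010.boxes,
      klU0_d010_t0float_2loop_C4_0.ThirdOrderEnclosures ((bx.mulo : ℚ) : ℝ)
          (bx.bB1g.trialFun klCertB1gD010.trials) →
        ∃ ψ : Momentum → ℝ, IsChannelState (squareDispersion 1 0) ((bx.mulo : ℚ) : ℝ) D4Irrep.B1g ψ ∧
          ∀ U : ℝ, 0 < U → U ≤ 1091 / 4096 → ∀ χ : D4Irrep, χ ≠ D4Irrep.B1g →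
            ∀ φ : Momentum → ℝ, IsChannelState (squareDispersion 1 0) ((bx.mulo : ℚ) : ℝ) χ φ →
              thirdOrderForm (squareDispersion 1 0) ((bx.mulo : ℚ) : ℝ) U ψ <
                thirdOrderForm (squareDispersion 1 0) ((bx.mulo : ℚ) : ℝ) U φ := by
  intro bx hbx h3
  obtain ⟨ψ, hψ, h⟩ := klThirdOrder_selection_d010_of_row hE _ klU0_d010_t0float_2loop_C4_0_ok
    klto_d010_t0float_dominates bx hbx h3
  refine ⟨ψ, hψ, fun U hU hUU => h U hU ?_⟩
  have hU0 : klU0_d010_t0float_2loop_C4_0.U0 = (1091 : ℚ) / 4096 := rfl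
  rw [hU0]
  push_cast
  exact hUU

end Summit.HubbardSuperconductivity.HubbardSuperconductivity.Theorems

end
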